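import Literature.Analysis.FluidPDE.FluidComputer.ThresholdLevelTableU
import HarnessLib

/-!
# Kernel run of the re-cut table over the 10⁻² box, chunks 56 … 59 (bp3 gen 13, layer 4: robustness variant U)

HONEST FRAMING: low prior, high value-of-information experiment on Tao's machine paradigm; NOT a
claim that NS blows up.

Four kernel evaluations (`decide +kernel`; no `native_decide`, no extra axioms) of the checker
`runSteps` (`ThresholdLevelCheck.lean`) with the interval gate data `GIu` (all seven data within
relative `10⁻²`) on ≤ 25 steps of `ThresholdLevelTableU.stepsU` at a time, from `Bu i` towards the next chunk's
first level, returning `Bu (i+1)` (`Bu 0 = ThresholdLevelTable.Bc0`).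
-/

namespace Literature.Analysis.FluidPDE.FluidComputer

namespace ThresholdLevelTableU

open ThresholdLevelTable (Bc0 RbIt)

set_option maxHeartbeats 10000000 in
set_option maxRecDepth 200000 in
/-- Chunk 56 of the re-cut table run over the 10⁻² box (steps 1400 … 1424). [folklore] -/
theorem runU56 : runSteps 60 12 3 GIu RbIt Bu56 chunkU56 67231944845700304 = some Bu57 := by
  decide +kernel

set_option maxHeartbeats 10000000 in
set_option maxRecDepth 200000 in
/-- Chunk 57 of the re-cut table run over the 10⁻² box (steps 1425 … 1449). [folklore] -/
theorem runU57 : runSteps 60 12 3 GIu RbIt Bu57 chunkU57 73345994452495776 = some Bu58 := by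
  decide +kernel

set_option maxHeartbeats 10000000 in
set_option maxRecDepth 200000 in
/-- Chunk 58 of the re-cut table run over the 10⁻² box (steps 1450 … 1474). [folklore] -/
theorem runU58 : runSteps 60 12 3 GIu RbIt Bu58 chunkU58 80017023640420304 = some Bu59 := by
  decide +kernel

set_option maxHeartbeats 10000000 in
set_option maxRecDepth 200000 in
/-- Chunk 59 of the re-cut table run over the 10⁻² box (steps 1475 … 1499). [folklore] -/
theorem runU59 : runSteps 60 12 3 GIu RbIt Bu59 chunkU59 87293743852046672 = some Bu60 := by
  decide +kernel

end ThresholdLevelTableU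

end Literature.Analysis.FluidPDE.FluidComputer
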